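import Summits.BirchSwinnertonDyer.BirchSwinnertonDyer.Theorems.KimAtThreeDeepUpperPortSharedOfFineKato
import Summits.BirchSwinnertonDyer.BirchSwinnertonDyer.Theses.KimAtThreeKolyvagin
import HarnessLib

/-!
# The registered stub `stub_oneLevel` of crux `KatoKuriharaPortThreeShared`
# (stmt-BirchSwinnertonDyer-19560, BC3 skeleton `Cruxes/KatoKuriharaPortThreeShared/Lines/birth.lean`)
# FROM THE FINE KATO PACKAGE (C1) — the skeleton's stub 1 is tied to the crux's single residual
# (cell `bsd-addord`, seat w2-acc4 gen 2 = PROGRAMME PART 1b row (4) `19560 / stub_oneLevel`;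
# route W2 `KimAtThreeKolyvagin`; w2-c3 gen 5 p471554, kim3 p448445)

HONEST FRAMING: one theorem, no definition, no named fact, no `sorry`; nothing is booked; BSD is not
proved; the crux 19560 is NOT closed and the stub is NOT landed unconditionally.  State of record
(HOME STATUS l.959 / l.962): 19560 ⟸ ⟨C1⟩ alone (`KimAtThreeDeepUpperPortSharedOfFineKato.
katoKuriharaPortThreeShared_of_fineKato : C1 → KatoKuriharaPortThreeShared`, w2-c3 gen 5), where ⟨C1⟩ =
the FINE KATO PACKAGE (Kato's `ZetaBody` family for `P.f` with the finite-level dual-exponential rider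
`KatoExpStarFiniteLevelAt` and the `ω`-normalisation of Kato's constant) is CONSTRUCTION-SHAPED: its
honest home is the definition item `defn-BlochKatoDualExponential` (planner, 2026-08-26T22:54Z).

## What

The planner's BC3 birth skeleton for 19560 has two stubs, `stub_oneLevel` (Kim 2022 Thm. 3.13 at ONE
depth `k′`: witnesses `KatoKuriharaWitnessAt W k′ 0 D′ v₃ P κu Λu κu′`) and `stub_descend`, composed by
`KatoKuriharaPortThreeShared_of`.  The cell's road to 19560 (kim3 g10 → w2-c3 g4/g5) bypassed the
skeleton: PORT″ `KatoKuriharaPortThreeAtWith₂ W 0 v₃ η P` is served at every Kato-stratum row from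
⟨C1⟩.  THIS FILE records, in the kernel, that the REGISTERED stub 1 is served by the same single
residual: `stub_oneLevel_of_fineKato : C1 → <signature of stub_oneLevel VERBATIM>` — PORT″ at the row
(from ⟨C1⟩ by p471554), unfolded at `k = k′`, `D = D′`, `red = id` (the pin `red x = 3^{k′−k′}·x` is
`one_smul`), keeping the depth-`k′` half of the two-level conclusion.  So the skeleton road reads
19560 ⟸ ⟨C1⟩ + `stub_descend` (pure reduction functoriality, MR04 App. A (33)), consistent with the
tenure reading 19560 ⟸ ⟨C1⟩; (C1) is displayed — this theorem does not land the stub.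

References: C.-H. Kim, AJM 148 = arXiv:2203.12159 Thm. 3.13 [Kim2022StructureSelmer]; K. Kato,
Astérisque 295 (2004) (8.1.3), Prop. 8.12, Thm. 9.7, Thm. 6.6 (1), Ex. 13.3 [Kato2004Asterisque];
B. Mazur, K. Rubin, Mem. AMS 799 (2004) Thm. 3.2.4, App. A [MazurRubin2004]; planner skeleton
`Cruxes/KatoKuriharaPortThreeShared/Lines/birth.lean`; kim3 memo HOME/kim3/KIM3-W2-C1-g11.md.
-/

noncomputable section

-- the cell's Theorems namespace `Summit.BirchSwinnertonDyer.BirchSwinnertonDyer.…` repeats the summit name by design (D-0017)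
set_option linter.dupNamespace false

open scoped NumberField TensorProduct Classical ContRepresentation
open Field Finset IsDedekindDomain NumberField WeierstrassCurve Rat.HeightOneSpectrum
open Literature.NumberTheory.GaloisRepresentations Literature.NumberTheory.GaloisCohomology
open Literature.NumberTheory.GaloisRepresentations.DiscreteGaloisModule
open Literature.NumberTheory.EllipticCurves Literature.NumberTheory.EllipticCurves.ModularForms
open Literature.NumberTheory.EllipticCurves.Rank1Residual
open Literature.NumberTheory.EllipticCurves.Kato2004
open Literature.NumberTheory.EllipticCurves.Kato2004.EulerSystemValues
open Summit.BirchSwinnertonDyer.Rank1Residual.GaloisImage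
open Summit.BirchSwinnertonDyer.BirchSwinnertonDyer.Theorems

namespace Summit.BirchSwinnertonDyer.BirchSwinnertonDyer.Theorems.KimAtThreePortSharedStubOneLevelOfFineKato

/-- **The registered stub `stub_oneLevel` (BC3 skeleton of 19560, signature VERBATIM) FROM THE FINE
KATO PACKAGE (C1)**: at every Kato-stratum row (tower-surjective `W` additive at `3`, `3 ∤ c₃`,
`E(ℚ₃)[3] = 0`, `v₃ ∣ 3`, a generator family `η` of the `(ℤ/q)ˣ`, a lattice-optimal parametrisation datum
`P` of conductor level with `3 ∤ c_P` and `3`-adic-unit period transfer), every depth `k′` and every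
canonical `τ`-datum `D′` for `η` carry one-level Kato–Kurihara witnesses
`KatoKuriharaWitnessAt W k′ 0 D′ v₃ P κu Λu κu′` — PORT″ from (C1) (w2-c3 gen 5
`katoKuriharaPortThreeShared_of_fineKato`) unfolded at `k = k′`, `D = D′`, `red = id`.  (C1) displayed;
the stub is NOT landed by this theorem; nothing is booked.
[cite: Kim2022StructureSelmer, Thm. 3.13 and §3.3–§3.4.1]
[cite: Kato2004Asterisque, (8.1.3) (p. 180), Prop. 8.12 (p. 186), §9.4 and Thm. 9.7 (pp. 188–189), Thm. 6.6 (1) (p. 163), Ex. 13.3 (pp. 224–225)]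
[cite: MazurRubin2004, Thm. 3.2.4 and App. A Remark A.5] -/
theorem stub_oneLevel_of_fineKato
    (hC1 : ∀ (W : WeierstrassCurve ℚ) [W.IsElliptic] [W.IsGloballyMinimal]
      [ContinuousSMul ℤ_[3] (W.tateModule 3)] [Module.Free ℤ_[3] (W.tateModule 3)]
      [Module.Finite ℤ_[3] (W.tateModule 3)],
      (∀ m : ℕ, W.HasSurjectiveModNGaloisRep (3 ^ m : ℕ)) →
      (haveI : Fact (Nat.Prime 3) := ⟨Nat.prime_three⟩; Addv W 3) →
      ¬ 3 ∣ (W.baseChange ℚ_[3]).localTamagawaNumber ℤ_[3] →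
      Nat.card {Q : (W.baseChange ℚ_[3]).toAffine.Point // (3 : ℕ) • Q = 0} = 1 →
      ∀ (v₃ : HeightOneSpectrum (𝓞 ℚ)), ((3 : ℕ) : 𝓞 ℚ) ∈ v₃.asIdeal →
      ∀ {N : ℕ} [NeZero N] (P : ModularParametrizationData W N), N = W.conductorNorm ℤ →
        (∀ z ∈ P.L.lattice, ∃ w ∈ periodLattice P.f, z = P.c * w) →
        ¬ (3 : ℤ) ∣ P.maninConstant →
        ∃ (ι : (n : ℕ) → (CyclotomicField n ℚ →+* ℂ)) (κK : ℝ)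
          (Λ : ∀ (k' : ℕ) (r : Finset (HeightOneSpectrum (𝓞 ℚ))),
            H1 (tateRep W 3) (cycSubgroup 3 k' r) →ₗ[ℤ_[3]]
              ℚ_[3] ⊗[ℚ] CyclotomicField (cycLevel 3 k' r) ℚ)
          (Λfin : ∀ j : ℕ, galoisCohomology
            ((W.torsionGaloisModule (((3 : ℕ) : ℤ) ^ j * ((3 : ℕ) : ℤ))).toLocal (Sum.inr v₃)) 1 →+
              ZMod (3 ^ (j + 1))),
          κK ≠ 0 ∧ (∃ u : ℚ, (u : ℝ) = κK ∧ padicValRat 3 u = 0) ∧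
          (∀ j : ℕ, KatoExpStarFiniteLevelAt W 3 j 0 v₃ Λ (Λfin j)) ∧
          ∀ (c d a : ℤ) (A : ℕ), 0 < A → Int.gcd c (6 * 3 * A) = 1 → Int.gcd d (6 * 3 * N) = 1 →
            ∃ (z : ∀ (k' : ℕ) (r : (cyclotomicLevelsRat 3 (badPlaces c d A N)).Ideals),
                  H1 (tateRep W 3) ((cyclotomicLevelsRat 3 (badPlaces c d A N)).level k' r.1))
              (x : ∀ (k' : ℕ) (r : (cyclotomicLevelsRat 3 (badPlaces c d A N)).Ideals),
                  CyclotomicField (cycLevel 3 k' r.1) ℚ),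
              ZetaBody W 3 P.f ι κK Λ c d a A z x) :
    ∀ (W : WeierstrassCurve ℚ) [W.IsElliptic] [W.IsGloballyMinimal],
      (∀ m : ℕ, W.HasSurjectiveModNGaloisRep (3 ^ m : ℕ)) →
      (haveI : Fact (Nat.Prime 3) := ⟨Nat.prime_three⟩; Addv W 3) →
      ¬ 3 ∣ (W.baseChange ℚ_[3]).localTamagawaNumber ℤ_[3] →
      Nat.card {Q : (W.baseChange ℚ_[3]).toAffine.Point // (3 : ℕ) • Q = 0} = 1 →
      ∀ (v₃ : HeightOneSpectrum (𝓞 ℚ)), ((3 : ℕ) : 𝓞 ℚ) ∈ v₃.asIdeal →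
      ∀ (η : (q : HeightOneSpectrum (𝓞 ℚ)) → (ZMod (Ideal.absNorm q.asIdeal))ˣ),
        (∀ q, Subgroup.zpowers (η q) = ⊤) →
      ∀ {N : ℕ} [NeZero N] (P : ModularParametrizationData W N), N = W.conductorNorm ℤ →
        (∀ z ∈ P.L.lattice, ∃ w ∈ periodLattice P.f, z = P.c * w) →
        ¬ (3 : ℤ) ∣ P.maninConstant →
        (∃ u : ℚ, ‖(u : ℚ_[3])‖ = 1 ∧ W.realPeriodRat = u * plusPeriod P.f) →
      ∀ (k' : ℕ) (D' : KolyvaginDatum (W.torsionGaloisModule (((3 : ℕ) : ℤ) ^ k' * ((3 : ℕ) : ℤ)))),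
        D'.IsCanonicalTauDatumThreeAtWith W k' k' η →
        ∃ (κu : Finset (HeightOneSpectrum (𝓞 ℚ)) →
              galoisCohomology (W.torsionGaloisModule (((3 : ℕ) : ℤ) ^ k' * ((3 : ℕ) : ℤ))) 1)
          (Λu : galoisCohomology ((W.torsionGaloisModule (((3 : ℕ) : ℤ) ^ k' * ((3 : ℕ) : ℤ))).toLocal
              (Sum.inr v₃)) 1 →+ ZMod (3 ^ (k' + 1)))
          (κu' : Finset (HeightOneSpectrum (𝓞 ℚ)) →
              galoisCohomology (W.torsionGaloisModule (((3 : ℕ) : ℤ) ^ k' * ((3 : ℕ) : ℤ))) 1),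
          KatoKuriharaWitnessAt W k' 0 D' v₃ P κu Λu κu' := by
  intro W _ _ htow hadd hc3 ht v₃ hv₃ η hη N _ P hN hlat hman hper k' D' hD'
  haveI : Fact (Nat.Prime 3) := ⟨Nat.prime_three⟩
  -- PORT″ at the row, from (C1) (w2-c3 gen 5)
  have hport : KatoKuriharaPortThreeAtWith₂ W 0 v₃ η P :=
    KimAtThreeDeepUpperPortSharedOfFineKato.katoKuriharaPortThreeShared_of_fineKato hC1
      W htow hadd hc3 ht v₃ hv₃ η hη P hN hlat hman
  -- unfold it at `k = k′`, `D = D′`, `red = id`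
  have hdict := hport k' k' D' D' ContIntertwiningMap.id hD' hD'
  have hpin : ∀ x : geomTorsion W (((3 : ℕ) : ℤ) ^ k' * ((3 : ℕ) : ℤ)),
      (((ContIntertwiningMap.id :
          (W.torsionGaloisModule (((3 : ℕ) : ℤ) ^ k' * ((3 : ℕ) : ℤ))).toContRepresentation →ⁱL
            (W.torsionGaloisModule (((3 : ℕ) : ℤ) ^ k' * ((3 : ℕ) : ℤ))).toContRepresentation) x :
          geomTorsion W (((3 : ℕ) : ℤ) ^ k' * ((3 : ℕ) : ℤ))) : geomPoints W) =
        (((3 : ℕ) : ℤ) ^ (k' - k')) • ((x : geomTorsion W (((3 : ℕ) : ℤ) ^ k' * ((3 : ℕ) : ℤ))) :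
          geomPoints W) := by
    intro x
    rw [ContIntertwiningMap.id_apply, Nat.sub_self, pow_zero, one_smul]
  have hsurj : W.HasSurjectiveModNGaloisRep ((3 : ℕ) : ℤ) := by simpa using htow 1
  have ht' : Nat.card {Q : (W.baseChange ℚ_[3]).toAffine.Point // (3 : ℕ) • Q = 0} = 3 ^ 0 := by
    rw [pow_zero]; exact ht
  have hman' : ¬ ((3 : ℕ) : ℤ) ∣ P.maninConstant := by exact_mod_cast hman
  obtain ⟨κ, Λ, κ', κu, Λu, κu', -, hWu, -⟩ :=
    hdict le_rfl hpin hadd hc3 hsurj ht' hv₃ hman' hper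
  exact ⟨κu, Λu, κu', hWu⟩

end Summit.BirchSwinnertonDyer.BirchSwinnertonDyer.Theorems.KimAtThreePortSharedStubOneLevelOfFineKato

end
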